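import Literature.NumberTheory.CubicFields.ShintaniGammaFactors
import Literature.Analysis.Complex.VerticalLineShift
import Mathlib.Analysis.SpecialFunctions.JapaneseBracket
import Mathlib.Algebra.Group.ForwardDiff
import Mathlib.Analysis.Calculus.MeanValue
import Mathlib.Analysis.Calculus.Deriv.Shift
import HarnessLib

/-!
# The Landau kernel integral `T^ε(ν, X) = (1/2πi)∫_{(σ)} G^ε(w) ν^{−w} X^{4−w} dw` and its third differences

Topic `Literature/NumberTheory/CubicFields` (the analytic side of Bhargava–Taniguchi–Thorne 2023, §3, following
Lowry-Duda–Taniguchi–Thorne [LDTT] §2.2–2.3, in the BESSEL-FREE weak form). After the Riesz mean of order `k = 3` of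
`ξ(s, Φ_m)` is moved to a line `Re s = 1 − c'` and the functional equation (eq:FE) is inserted, the dual series
`Σ_n b_n` appears against the kernel ([LDTT] (eq:Idef), (eq:def_Wp))

  `T^ε_σ(ν, X) := (1/2π) ∫ G^ε(σ + iu) ν^{−(σ+iu)} X^{4−(σ+iu)} du`,  `ν = n/m⁴`,

`G^ε = 6Δ^ε(w)/(Δ^ε(1−w)(1−w)(2−w)(3−w)(4−w))` (`ShintaniGammaFactors.lean`). This file PROVES:

* `LandauDiff.*` — the calculus of iterated forward differences `Δ_y^n` (Mathlib's `fwdDiff`) of a family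
  `g_k` with `g_k' = g_{k+1}`: `Δ_y^n` commutes with `d/dt` (`hasDerivAt_fwdDiff_iter`) and the mean-value bound
  `‖Δ_y^n g_k(t)‖ ≤ y^n sup_{[t, t+ny]} ‖g_{k+n}‖` (`norm_fwdDiff_iter_le`), whence for complex powers
  `‖Δ_y^3 (t ↦ t^w)(X)‖ ≤ y³ ‖w(w−1)(w−2)‖ max(X^{Re w−3}, (X+3y)^{Re w−3})` (`norm_fwdDiff_three_cpow_le`) —
  [LDTT] (eq:finite_diff_iterated) in inequality form;
* `kernelT ε σ ν X` — the kernel, absolutely convergent for `1/6 < σ < 5/4` (`integrable_kernelIntegrand`),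
  INDEPENDENT of `σ` in that range (`kernelT_eq_of_mem`, a pole-free shift of the line:
  `Literature.Analysis.Complex.integral_vertical_eq_of_differentiableOn`), with the trivial bound
  `‖T^ε_σ(ν, X)‖ ≤ C ν^{−σ} X^{4−σ}` (`norm_kernelT_le`, [LDTT] Lemma 6 without the Bessel saving `t^{−1/4A}`) and
  the differenced bound `‖Δ_y^3 T^ε_σ(ν, ·)(X)‖ ≤ C y³ ν^{−σ} (X + 3y)^{1−σ}` for `1/6 < σ < 1/2`
  (`norm_fwdDiff_three_kernelT_le`, [LDTT] Lemma 8, second case, again without `−1/4A`).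

The missing `1/(4A) = 1/8` in the exponents is exactly the `J`-Bessel cancellation of [LDTT] Lemma 6 (Mathlib has no
Bessel functions); the weak bounds give Landau's theorem with `X^{1−θ} δ₁^{1−θ} δ̂₁^{θ}` for every `θ < 1/3` instead of
`θ = 2/5`, which is all that (3) of [BTT] needs. Theorem-only file apart from the two definitions `kernelIntegrand`,
`kernelT` (no named facts).

## References

* D. Lowry-Duda, T. Taniguchi, F. Thorne, *Uniform bounds for lattice point counting and partial sums of zeta
  functions*, Math. Z. 300 (2022) = arXiv:1710.02190, §2.2 ((eq:Idef), (eq:def_Wp), Lemmas 6–8, (eq:finite_diff_iterated)).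
  [LowrydudaTaniguchiThorne2017]
* M. Bhargava, T. Taniguchi, F. Thorne, *Improved error estimates for the Davenport–Heilbronn theorems*,
  Math. Ann. 389 (2024) = arXiv:2107.12819, §3 (proof of Thm 3.1: "the integral `I_k(t)` and its derivatives").
  [BhargavaTaniguchiThorne2023]
-/

noncomputable section

open Complex Real Set Filter Topology MeasureTheory

namespace Literature.NumberTheory.CubicFields

/-! ## Iterated forward differences: derivative and mean-value bound -/

namespace LandauDiff

/-- **`Δ_y^n` commutes with differentiation**: if `f` has derivative `f'` on `(0, ∞)` then `Δ_y^n f` has derivative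
`Δ_y^n f'` at every `t > 0` (`y ≥ 0`). [cite: LowrydudaTaniguchiThorne2017, §2.3 (eq:finite_diff_iterated)] -/
theorem hasDerivAt_fwdDiff_iter {f f' : ℝ → ℂ} (hf : ∀ t : ℝ, 0 < t → HasDerivAt f (f' t) t) {y : ℝ} (hy : 0 ≤ y) :
    ∀ (n : ℕ) (t : ℝ), 0 < t → HasDerivAt ((fwdDiff y)^[n] f) (((fwdDiff y)^[n] f') t) t := by
  intro n
  induction n with
  | zero => intro t ht; simpa using hf t ht
  | succ n ih =>
    intro t ht
    rw [Function.iterate_succ_apply', Function.iterate_succ_apply']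
    simp only [fwdDiff]
    exact ((ih (t + y) (by linarith)).comp_add_const t y).sub (ih t ht)

/-- `Δ_y^n f` is differentiable at `t > 0`. [folklore] -/
theorem differentiableAt_fwdDiff_iter {f f' : ℝ → ℂ} (hf : ∀ t : ℝ, 0 < t → HasDerivAt f (f' t) t) {y : ℝ}
    (hy : 0 ≤ y) (n : ℕ) {t : ℝ} (ht : 0 < t) : DifferentiableAt ℝ ((fwdDiff y)^[n] f) t :=
  (hasDerivAt_fwdDiff_iter hf hy n t ht).differentiableAt

/-- **The mean-value bound for iterated differences of a derivative-closed family**: if `g_k' = g_{k+1}` on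
`(0, ∞)` for all `k`, then `‖Δ_y^n g_k(t)‖ ≤ y^n · B` whenever `‖g_{k+n}‖ ≤ B` on `[t, t + ny]` (`t > 0`, `y ≥ 0`).
[cite: LowrydudaTaniguchiThorne2017, §2.3 (eq:finite_diff_iterated) (Δ_y^k F as an iterated integral of F^{(k)})] -/
theorem norm_fwdDiff_iter_le {g : ℕ → ℝ → ℂ} (hg : ∀ k : ℕ, ∀ t : ℝ, 0 < t → HasDerivAt (g k) (g (k + 1) t) t)
    {y : ℝ} (hy : 0 ≤ y) :
    ∀ (n k : ℕ) (t : ℝ), 0 < t → ∀ B : ℝ, (∀ s ∈ Icc t (t + n * y), ‖g (k + n) s‖ ≤ B) →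
      ‖((fwdDiff y)^[n] (g k)) t‖ ≤ y ^ n * B := by
  intro n
  induction n with
  | zero =>
    intro k t ht B hB
    simpa using hB t ⟨le_rfl, by simp⟩
  | succ n ih =>
    intro k t ht B hB
    rw [Function.iterate_succ_apply']
    simp only [fwdDiff]
    -- `φ = Δ_y^n g_k` has derivative `Δ_y^n g_{k+1}`, bounded by `y^n B` on `[t, t + y]`
    have hderiv : ∀ s ∈ Icc t (t + y), HasDerivWithinAt ((fwdDiff y)^[n] (g k)) (((fwdDiff y)^[n] (g (k + 1))) s) (Icc t (t + y)) s :=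
      fun s hs => (hasDerivAt_fwdDiff_iter (hg k) hy n s (lt_of_lt_of_le ht hs.1)).hasDerivWithinAt
    have hbound : ∀ s ∈ Ico t (t + y), ‖((fwdDiff y)^[n] (g (k + 1))) s‖ ≤ y ^ n * B := by
      intro s hs
      refine ih (k + 1) s (lt_of_lt_of_le ht hs.1) B fun s' hs' => ?_
      rw [show k + 1 + n = k + (n + 1) by omega]
      refine hB s' ⟨hs.1.trans hs'.1, hs'.2.trans ?_⟩
      push_cast
      nlinarith [hs.2]
    have h := norm_image_sub_le_of_norm_deriv_le_segment' hderiv hbound (t + y) ⟨by linarith, le_rfl⟩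
    calc ‖((fwdDiff y)^[n] (g k)) (t + y) - ((fwdDiff y)^[n] (g k)) t‖ ≤ y ^ n * B * (t + y - t) := h
      _ = y ^ (n + 1) * B := by ring

/-! ### The family `g_k(t) = w(w−1)⋯(w−k+1) t^{w−k}` -/

/-- `g_k(t) := (∏_{j<k} (w − j)) · t^{w − k}` (complex power of the positive real `t`). [folklore] -/
def cpowFamily (w : ℂ) (k : ℕ) (t : ℝ) : ℂ := (∏ j ∈ Finset.range k, (w - j)) * (t : ℂ) ^ (w - k)

/-- `g_0(t) = t^w`. [folklore] -/
theorem cpowFamily_zero (w : ℂ) (t : ℝ) : cpowFamily w 0 t = (t : ℂ) ^ w := by simp [cpowFamily]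

/-- `g_k' = g_{k+1}` on `t > 0`. [folklore] -/
theorem hasDerivAt_cpowFamily (w : ℂ) (k : ℕ) {t : ℝ} (ht : 0 < t) :
    HasDerivAt (cpowFamily w k) (cpowFamily w (k + 1) t) t := by
  have hslit : (t : ℂ) ∈ slitPlane := ofReal_mem_slitPlane.2 ht
  have h1 : HasDerivAt (fun x : ℝ => (x : ℂ) ^ (w - k)) ((w - k) * (t : ℂ) ^ (w - k - 1)) t :=
    (Complex.hasStrictDerivAt_cpow_const hslit).hasDerivAt.comp_ofReal
  have h2 : HasDerivAt (cpowFamily w k) ((∏ j ∈ Finset.range k, (w - j)) * ((w - k) * (t : ℂ) ^ (w - k - 1))) t :=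
    h1.const_mul (∏ j ∈ Finset.range k, (w - j))
  convert h2 using 1
  rw [cpowFamily, Finset.prod_range_succ]
  push_cast
  ring_nf

/-- `‖g_k(s)‖ = ‖∏_{j<k}(w − j)‖ · s^{Re w − k}` for `s > 0`. [folklore] -/
theorem norm_cpowFamily {w : ℂ} {k : ℕ} {s : ℝ} (hs : 0 < s) :
    ‖cpowFamily w k s‖ = ‖∏ j ∈ Finset.range k, (w - j)‖ * s ^ (w.re - k) := by
  rw [cpowFamily, norm_mul, norm_cpow_eq_rpow_re_of_pos hs]
  simp

/-- `s^a ≤ max(X^a, (X + L)^a)` for `s ∈ [X, X + L]`, `X > 0` (monotone or antitone in the base). [folklore] -/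
theorem rpow_le_max_of_mem_Icc {X L s a : ℝ} (hX : 0 < X) (hs : s ∈ Icc X (X + L)) :
    s ^ a ≤ max (X ^ a) ((X + L) ^ a) := by
  rcases le_total 0 a with ha | ha
  · exact (Real.rpow_le_rpow (by linarith [hs.1]) hs.2 ha).trans (le_max_right _ _)
  · exact (Real.rpow_le_rpow_of_nonpos hX hs.1 ha).trans (le_max_left _ _)

/-- **`‖Δ_y^3 (t ↦ t^w)(X)‖ ≤ y³ ‖w(w−1)(w−2)‖ max(X^{Re w − 3}, (X + 3y)^{Re w − 3})`** for `X > 0`, `y ≥ 0`.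
[cite: LowrydudaTaniguchiThorne2017, §2.3 (proof of Lemma 8: Δ_y^k I via (eq:finite_diff_iterated))] -/
theorem norm_fwdDiff_three_cpow_le (w : ℂ) {X y : ℝ} (hX : 0 < X) (hy : 0 ≤ y) :
    ‖((fwdDiff y)^[3] (fun t : ℝ => (t : ℂ) ^ w)) X‖ ≤
      y ^ 3 * (‖w * (w - 1) * (w - 2)‖ * max (X ^ (w.re - 3)) ((X + 3 * y) ^ (w.re - 3))) := by
  have hfam : (fun t : ℝ => (t : ℂ) ^ w) = cpowFamily w 0 := by funext t; rw [cpowFamily_zero]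
  rw [hfam]
  refine norm_fwdDiff_iter_le (hasDerivAt_cpowFamily w) hy 3 0 X hX _ fun s hs => ?_
  have hs0 : 0 < s := lt_of_lt_of_le hX hs.1
  rw [zero_add, norm_cpowFamily hs0]
  have hprod : ‖∏ j ∈ Finset.range 3, (w - j)‖ = ‖w * (w - 1) * (w - 2)‖ := by
    simp [Finset.prod_range_succ]
  rw [hprod]
  push_cast at hs ⊢
  exact mul_le_mul_of_nonneg_left (rpow_le_max_of_mem_Icc hX hs) (norm_nonneg _)

/-- `Δ_y^3` of a function, written out. [folklore] -/
theorem fwdDiff_iter_three_apply (f : ℝ → ℂ) (y X : ℝ) :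
    ((fwdDiff y)^[3] f) X = f (X + 3 * y) - 3 * f (X + 2 * y) + 3 * f (X + y) - f X := by
  simp only [Function.iterate_succ_apply', Function.iterate_zero_apply, fwdDiff]
  ring_nf

end LandauDiff

/-! ## The kernel `T^ε_σ(ν, X)` -/

namespace ShintaniGamma

open LandauDiff

/-- The integrand `G^ε(w) ν^{−w} X^{4−w}`. [cite: LowrydudaTaniguchiThorne2017, §2.2 (eq:Idef), (eq:def_Wp)] -/
def kernelIntegrand (ε : ℤ) (ν X : ℝ) (w : ℂ) : ℂ := kernelG ε w * ((ν : ℂ) ^ (-w) * (X : ℂ) ^ (4 - w))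

/-- **`T^ε_σ(ν, X) := (1/2π) ∫ G^ε(σ + iu) ν^{−(σ+iu)} X^{4−(σ+iu)} du`** (`= (1/2πi) ∫_{(σ)} G^ε(w) ν^{−w} X^{4−w} dw`).
[cite: LowrydudaTaniguchiThorne2017, §2.2 (eq:Idef) (the kernel I_k, k = 3, at t = νX up to the normalisation ν^{-(1+k)})] -/
def kernelT (ε : ℤ) (σ ν X : ℝ) : ℂ :=
  (1 / (2 * π) : ℂ) * ∫ u : ℝ, kernelIntegrand ε ν X ((σ : ℂ) + u * I)

/-- Norm of the integrand on `Re w = σ`: `‖G^ε(σ+iu)‖ ν^{−σ} X^{4−σ}`. [folklore] -/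
theorem norm_kernelIntegrand {ν X : ℝ} (hν : 0 < ν) (hX : 0 < X) (ε : ℤ) (w : ℂ) :
    ‖kernelIntegrand ε ν X w‖ = ‖kernelG ε w‖ * (ν ^ (-w.re) * X ^ (4 - w.re)) := by
  rw [kernelIntegrand, norm_mul, norm_mul, norm_cpow_eq_rpow_re_of_pos hν, norm_cpow_eq_rpow_re_of_pos hX]
  simp

/-- The integrand is holomorphic on `Re w > 1/6`. [folklore] -/
theorem differentiableOn_kernelIntegrand {ν X : ℝ} (hν : 0 < ν) (hX : 0 < X) (ε : ℤ) :
    DifferentiableOn ℂ (kernelIntegrand ε ν X) {w : ℂ | 1 / 6 < w.re} := by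
  have h1 : Differentiable ℂ fun w : ℂ => (ν : ℂ) ^ (-w) :=
    Differentiable.const_cpow (by fun_prop) (Or.inl (by exact_mod_cast hν.ne'))
  have h2 : Differentiable ℂ fun w : ℂ => (X : ℂ) ^ (4 - w) :=
    Differentiable.const_cpow (by fun_prop) (Or.inl (by exact_mod_cast hX.ne'))
  unfold kernelIntegrand
  exact (differentiableOn_kernelG ε).mul (h1.mul h2).differentiableOn

/-- The integrand is continuous along every line `Re w = σ > 1/6`. [folklore] -/
theorem continuous_kernelIntegrand_line {ν X : ℝ} (hν : 0 < ν) (hX : 0 < X) (ε : ℤ) {σ : ℝ} (hσ : 1 / 6 < σ) :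
    Continuous fun u : ℝ => kernelIntegrand ε ν X ((σ : ℂ) + u * I) := by
  have hline : Continuous fun u : ℝ => (σ : ℂ) + u * I := by fun_prop
  refine ((differentiableOn_kernelIntegrand hν hX ε).continuousOn).comp_continuous hline fun u => ?_
  show 1 / 6 < ((σ : ℂ) + u * I).re
  simpa using hσ

/-- **Absolute convergence on `Re w = σ ∈ (1/6, 5/4)`**, with the explicit majorant
`‖integrand‖ ≤ C ν^{−σ} X^{4−σ} (1 + |u|)^{4σ−6}`. [cite: LowrydudaTaniguchiThorne2017, §2.3 (proof of Lemma 6: absolute convergence of (eq:Idef))] -/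
theorem integrable_kernelIntegrand {ν X : ℝ} (hν : 0 < ν) (hX : 0 < X) {ε : ℤ} (hε : ε = 1 ∨ ε = -1) {σ : ℝ}
    (hσ₁ : 1 / 6 < σ) (hσ₂ : σ < 5 / 4) :
    Integrable fun u : ℝ => kernelIntegrand ε ν X ((σ : ℂ) + u * I) := by
  obtain ⟨C, hC, hG⟩ := exists_norm_kernelG_le (σ₂ := σ) hσ₁
  have hint : Integrable fun u : ℝ => C * (ν ^ (-σ) * X ^ (4 - σ)) * (1 + ‖u‖) ^ (-(6 - 4 * σ)) := by
    refine (integrable_one_add_norm (E := ℝ) (μ := volume) ?_).const_mul _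
    simp only [Module.finrank_self, Nat.cast_one]; linarith
  refine hint.mono' (continuous_kernelIntegrand_line hν hX ε hσ₁).aestronglyMeasurable (ae_of_all _ fun u => ?_)
  rw [norm_kernelIntegrand hν hX, Real.norm_eq_abs, show -(6 - 4 * σ) = 4 * σ - 6 by ring]
  simp only [add_re, ofReal_re, mul_re, I_re, mul_zero, ofReal_im, I_im, mul_one, sub_self, add_zero]
  have h := hG ε hε σ ⟨le_rfl, le_rfl⟩ u
  calc ‖kernelG ε ((σ : ℂ) + u * I)‖ * (ν ^ (-σ) * X ^ (4 - σ))
      ≤ C * (1 + |u|) ^ (4 * σ - 6) * (ν ^ (-σ) * X ^ (4 - σ)) := by gcongr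
    _ = C * (ν ^ (-σ) * X ^ (4 - σ)) * (1 + |u|) ^ (4 * σ - 6) := by ring

/-- **`T^ε_σ(ν, X)` does not depend on `σ ∈ (1/6, 5/4)`** (the integrand is holomorphic on `Re w > 1/6` and decays
like `|Im w|^{4 Re w − 6}`, uniformly on vertical strips; a pole-free shift of the line of integration).
[cite: LowrydudaTaniguchiThorne2017, §2.3 (proof of Lemma 6: "we shift the line of integration … we do not pass through any poles")] -/
theorem kernelT_eq_of_mem {ν X : ℝ} (hν : 0 < ν) (hX : 0 < X) {ε : ℤ} (hε : ε = 1 ∨ ε = -1) {σ σ' : ℝ}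
    (hσ : σ ∈ Ioo (1 / 6 : ℝ) (5 / 4)) (hσ' : σ' ∈ Ioo (1 / 6 : ℝ) (5 / 4)) :
    kernelT ε σ ν X = kernelT ε σ' ν X := by
  wlog hle : σ ≤ σ' generalizing σ σ'
  · exact (this hσ' hσ (le_of_not_ge hle)).symm
  unfold kernelT
  congr 1
  obtain ⟨C, hC, hG⟩ := exists_norm_kernelG_le (σ₂ := σ') hσ.1
  refine Literature.Analysis.Complex.integral_vertical_eq_of_differentiableOn hle
    ((differentiableOn_kernelIntegrand hν hX ε).mono fun w hw => lt_of_lt_of_le hσ.1 hw.1)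
    (integrable_kernelIntegrand hν hX hε hσ.1 hσ.2) (integrable_kernelIntegrand hν hX hε hσ'.1 hσ'.2)
    fun δ hδ => ?_
  -- decay on horizontal segments: `‖F(x + iT)‖ ≤ C M (1+|T|)^{4σ'−6} → 0`
  set M : ℝ := max (ν ^ (-σ)) (ν ^ (-σ')) * max (X ^ (4 - σ)) (X ^ (4 - σ')) with hM
  have hM0 : 0 < M := by positivity
  have hexp : 4 * σ' - 6 < 0 := by linarith [hσ'.2]
  -- choose `T₀` with `C M (1 + T₀)^{4σ'−6} ≤ δ`: `T₀ = (δ/(CM))^{1/(4σ'−6)}`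
  obtain ⟨T₀, hT₀⟩ : ∃ T₀ : ℝ, 0 ≤ T₀ ∧ C * M * (1 + T₀) ^ (4 * σ' - 6) ≤ δ := by
    set e : ℝ := 4 * σ' - 6 with he
    have he0 : e ≠ 0 := by linarith
    set T₀ : ℝ := (δ / (C * M)) ^ (1 / e) with hT₀def
    have hq : 0 < δ / (C * M) := by positivity
    have hT₀pos : 0 < T₀ := Real.rpow_pos_of_pos hq _
    refine ⟨T₀, hT₀pos.le, ?_⟩
    have h1 : (1 + T₀) ^ e ≤ T₀ ^ e := Real.rpow_le_rpow_of_nonpos hT₀pos (by linarith) hexp.le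
    have h2 : T₀ ^ e = δ / (C * M) := by
      rw [hT₀def, ← Real.rpow_mul hq.le, one_div_mul_cancel he0, Real.rpow_one]
    calc C * M * (1 + T₀) ^ e ≤ C * M * T₀ ^ e := by gcongr
      _ = δ := by rw [h2]; field_simp
  refine ⟨T₀, fun T hT x hx => ?_⟩
  have hx1 : 1 / 6 < x := lt_of_lt_of_le hσ.1 hx.1
  rw [norm_kernelIntegrand hν hX]
  simp only [add_re, ofReal_re, mul_re, I_re, mul_zero, ofReal_im, I_im, mul_one, sub_self, add_zero]
  have hGx := hG ε hε x hx T
  have hνx : ν ^ (-x) ≤ max (ν ^ (-σ)) (ν ^ (-σ')) := by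
    rcases le_total 1 ν with h1 | h1
    · exact (Real.rpow_le_rpow_of_exponent_le h1 (by linarith [hx.1] : -x ≤ -σ)).trans (le_max_left _ _)
    · exact (Real.rpow_le_rpow_of_exponent_ge hν h1 (by linarith [hx.2] : -σ' ≤ -x)).trans (le_max_right _ _)
  have hXx : X ^ (4 - x) ≤ max (X ^ (4 - σ)) (X ^ (4 - σ')) := by
    rcases le_total 1 X with h1 | h1
    · exact (Real.rpow_le_rpow_of_exponent_le h1 (by linarith [hx.1] : 4 - x ≤ 4 - σ)).trans (le_max_left _ _)
    · exact (Real.rpow_le_rpow_of_exponent_ge hX h1 (by linarith [hx.2] : 4 - σ' ≤ 4 - x)).trans (le_max_right _ _)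
  have hpow : (1 + |T|) ^ (4 * x - 6) ≤ (1 + T₀) ^ (4 * σ' - 6) := by
    calc (1 + |T|) ^ (4 * x - 6) ≤ (1 + |T|) ^ (4 * σ' - 6) :=
          Real.rpow_le_rpow_of_exponent_le (by linarith [abs_nonneg T]) (by linarith [hx.2])
      _ ≤ (1 + T₀) ^ (4 * σ' - 6) :=
          Real.rpow_le_rpow_of_nonpos (by linarith) (by linarith) hexp.le
  calc ‖kernelG ε ((x : ℂ) + T * I)‖ * (ν ^ (-x) * X ^ (4 - x))
      ≤ C * (1 + |T|) ^ (4 * x - 6) * M := by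
        refine mul_le_mul hGx ?_ (by positivity) (by positivity)
        exact mul_le_mul hνx hXx (by positivity) (by positivity)
    _ = C * M * (1 + |T|) ^ (4 * x - 6) := by ring
    _ ≤ C * M * (1 + T₀) ^ (4 * σ' - 6) := by gcongr
    _ ≤ δ := hT₀.2

/-- `∫ (1 + |u|)^a du < ∞` for `a < −1`, as a named finite constant. [folklore] -/
theorem integral_one_add_abs_rpow_nonneg (a : ℝ) : 0 ≤ ∫ u : ℝ, (1 + |u|) ^ a :=
  integral_nonneg fun u => by positivity

/-- **The trivial bound `‖T^ε_σ(ν, X)‖ ≤ C ν^{−σ} X^{4−σ}`**, uniformly for `σ ∈ [σ₁, σ₂] ⊂ (1/6, 5/4)`, `ε = ±1`,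
`ν, X > 0` ([LDTT] Lemma 6 without the Bessel factor `t^{−1/4A}`).
[cite: LowrydudaTaniguchiThorne2017, Lemma 6 (the bound for I_k(t) "by immediately bounding the integrand in (eq:Idef) absolutely")] -/
theorem exists_norm_kernelT_le {σ₁ σ₂ : ℝ} (h₁ : 1 / 6 < σ₁) (h₂ : σ₂ < 5 / 4) :
    ∃ C : ℝ, 0 < C ∧ ∀ ε : ℤ, (ε = 1 ∨ ε = -1) → ∀ σ ∈ Icc σ₁ σ₂, ∀ ν X : ℝ, 0 < ν → 0 < X →
      ‖kernelT ε σ ν X‖ ≤ C * (ν ^ (-σ) * X ^ (4 - σ)) := by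
  obtain ⟨C, hC, hG⟩ := exists_norm_kernelG_le (σ₂ := σ₂) h₁
  set J : ℝ := ∫ u : ℝ, (1 + |u|) ^ (4 * σ₂ - 6) with hJ
  have hJ0 : 0 ≤ J := integral_one_add_abs_rpow_nonneg _
  have hJint : Integrable fun u : ℝ => (1 + |u|) ^ (4 * σ₂ - 6) := by
    have := integrable_one_add_norm (E := ℝ) (μ := volume) (r := 6 - 4 * σ₂) (by simp; linarith)
    refine this.congr (ae_of_all _ fun u => ?_)
    simp only [Real.norm_eq_abs]; congr 1; ring
  refine ⟨1 / (2 * π) * C * J + 1, by positivity, fun ε hε σ hσ ν X hν hX => ?_⟩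
  have hσ1 : 1 / 6 < σ := lt_of_lt_of_le h₁ hσ.1
  have hσ2 : σ < 5 / 4 := lt_of_le_of_lt hσ.2 h₂
  set P : ℝ := ν ^ (-σ) * X ^ (4 - σ) with hP
  have hP0 : 0 < P := by positivity
  have hbound : ∀ u : ℝ, ‖kernelIntegrand ε ν X ((σ : ℂ) + u * I)‖ ≤ C * P * (1 + |u|) ^ (4 * σ₂ - 6) := by
    intro u
    rw [norm_kernelIntegrand hν hX]
    simp only [add_re, ofReal_re, mul_re, I_re, mul_zero, ofReal_im, I_im, mul_one, sub_self, add_zero]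
    have h := hG ε hε σ hσ u
    have hmono : (1 + |u|) ^ (4 * σ - 6) ≤ (1 + |u|) ^ (4 * σ₂ - 6) :=
      Real.rpow_le_rpow_of_exponent_le (by linarith [abs_nonneg u]) (by linarith [hσ.2])
    calc ‖kernelG ε ((σ : ℂ) + u * I)‖ * (ν ^ (-σ) * X ^ (4 - σ)) ≤ C * (1 + |u|) ^ (4 * σ - 6) * P := by
          rw [hP]; gcongr
      _ ≤ C * (1 + |u|) ^ (4 * σ₂ - 6) * P := by gcongr
      _ = C * P * (1 + |u|) ^ (4 * σ₂ - 6) := by ring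
  have hnorm : ‖∫ u : ℝ, kernelIntegrand ε ν X ((σ : ℂ) + u * I)‖ ≤ C * P * J := by
    calc ‖∫ u : ℝ, kernelIntegrand ε ν X ((σ : ℂ) + u * I)‖
        ≤ ∫ u : ℝ, C * P * (1 + |u|) ^ (4 * σ₂ - 6) :=
          norm_integral_le_of_norm_le (hJint.const_mul _) (ae_of_all _ hbound)
      _ = C * P * J := by rw [integral_const_mul]
  have h2π : ‖(1 / (2 * π) : ℂ)‖ = 1 / (2 * π) := by
    rw [show (1 / (2 * π) : ℂ) = ((1 / (2 * π) : ℝ) : ℂ) by push_cast; ring, Complex.norm_real, Real.norm_eq_abs,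
      abs_of_pos (by positivity)]
  calc ‖kernelT ε σ ν X‖ = 1 / (2 * π) * ‖∫ u : ℝ, kernelIntegrand ε ν X ((σ : ℂ) + u * I)‖ := by
        rw [kernelT, norm_mul, h2π]
    _ ≤ 1 / (2 * π) * (C * P * J) := by gcongr
    _ = (1 / (2 * π) * C * J) * P := by ring
    _ ≤ (1 / (2 * π) * C * J + 1) * P := by nlinarith

/-! ### The third difference in `X` -/

/-- `Δ_y^3` in `X` of the integrand is the integrand with `X^{4−w}` replaced by `Δ_y^3(X ↦ X^{4−w})`. [folklore] -/
theorem fwdDiff_three_kernelIntegrand (ε : ℤ) (ν y : ℝ) (w : ℂ) (X : ℝ) :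
    ((fwdDiff y)^[3] (fun X' : ℝ => kernelIntegrand ε ν X' w)) X =
      kernelG ε w * ((ν : ℂ) ^ (-w) * ((fwdDiff y)^[3] (fun X' : ℝ => ((X' : ℂ)) ^ (4 - w))) X) := by
  rw [fwdDiff_iter_three_apply, fwdDiff_iter_three_apply]
  simp only [kernelIntegrand]
  push_cast
  ring

/-- **`Δ_y^3 T^ε_σ(ν, ·)(X) = (1/2π) ∫ G^ε ν^{−w} Δ_y^3(X^{4−w}) du`** (linearity of the absolutely convergent integral).
[cite: LowrydudaTaniguchiThorne2017, §2.2 (eq:def_DeltaW) ("the finite difference is taken of I_k(μ_n X) as a function of X")] -/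
theorem fwdDiff_three_kernelT {ν X y : ℝ} (hν : 0 < ν) (hX : 0 < X) (hy : 0 ≤ y) {ε : ℤ} (hε : ε = 1 ∨ ε = -1)
    {σ : ℝ} (hσ₁ : 1 / 6 < σ) (hσ₂ : σ < 5 / 4) :
    ((fwdDiff y)^[3] (fun X' : ℝ => kernelT ε σ ν X')) X =
      (1 / (2 * π) : ℂ) * ∫ u : ℝ, ((fwdDiff y)^[3] (fun X' : ℝ => kernelIntegrand ε ν X' ((σ : ℂ) + u * I))) X := by
  have hint : ∀ j : ℝ, 0 ≤ j → Integrable fun u : ℝ => kernelIntegrand ε ν (X + j * y) ((σ : ℂ) + u * I) :=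
    fun j hj => integrable_kernelIntegrand hν (by positivity) hε hσ₁ hσ₂
  rw [fwdDiff_iter_three_apply]
  simp only [kernelT]
  have h3 := hint 3 (by norm_num)
  have h2 := hint 2 (by norm_num)
  have h1 := hint 1 (by norm_num)
  have h0 := hint 0 le_rfl
  simp only [one_mul, zero_mul, add_zero] at h1 h0
  have key : (∫ u : ℝ, ((fwdDiff y)^[3] (fun X' : ℝ => kernelIntegrand ε ν X' ((σ : ℂ) + u * I))) X) =
      (∫ u : ℝ, kernelIntegrand ε ν (X + 3 * y) ((σ : ℂ) + u * I)) -
        3 * (∫ u : ℝ, kernelIntegrand ε ν (X + 2 * y) ((σ : ℂ) + u * I)) +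
        3 * (∫ u : ℝ, kernelIntegrand ε ν (X + y) ((σ : ℂ) + u * I)) -
        ∫ u : ℝ, kernelIntegrand ε ν X ((σ : ℂ) + u * I) := by
    have h2' : Integrable fun u : ℝ => 3 * kernelIntegrand ε ν (X + 2 * y) ((σ : ℂ) + u * I) := h2.const_mul 3
    have h1' : Integrable fun u : ℝ => 3 * kernelIntegrand ε ν (X + y) ((σ : ℂ) + u * I) := h1.const_mul 3
    have hB : Integrable fun u : ℝ =>
        kernelIntegrand ε ν (X + 3 * y) ((σ : ℂ) + u * I) - 3 * kernelIntegrand ε ν (X + 2 * y) ((σ : ℂ) + u * I) :=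
      h3.sub h2'
    have hA : Integrable fun u : ℝ =>
        kernelIntegrand ε ν (X + 3 * y) ((σ : ℂ) + u * I) - 3 * kernelIntegrand ε ν (X + 2 * y) ((σ : ℂ) + u * I) +
          3 * kernelIntegrand ε ν (X + y) ((σ : ℂ) + u * I) := hB.add h1'
    simp_rw [fwdDiff_iter_three_apply]
    rw [integral_sub hA h0, integral_add hB h1', integral_sub h3 h2', integral_const_mul, integral_const_mul]
  rw [key]
  ring

/-- **The differenced bound `‖Δ_y^3 T^ε_σ(ν, ·)(X)‖ ≤ C y³ ν^{−σ} (X + 3y)^{1−σ}`** for `σ ∈ [σ₁, σ₂] ⊂ (1/6, 1/2)`,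
`ε = ±1`, `ν, X > 0`, `y ≥ 0` ([LDTT] Lemma 8, second case, without the Bessel factor: on `Re w = σ < 1/2` the
integrand `|u|^{4σ−6} · |u|³` of `Δ_y^3` is absolutely convergent).
[cite: LowrydudaTaniguchiThorne2017, Lemma 8 (second bound, via Lemma 6 for I_k^{(k)})] -/
theorem exists_norm_fwdDiff_three_kernelT_le {σ₁ σ₂ : ℝ} (h₁ : 1 / 6 < σ₁) (h₂ : σ₂ < 1 / 2) :
    ∃ C : ℝ, 0 < C ∧ ∀ ε : ℤ, (ε = 1 ∨ ε = -1) → ∀ σ ∈ Icc σ₁ σ₂, ∀ ν X y : ℝ, 0 < ν → 0 < X → 0 ≤ y →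
      ‖((fwdDiff y)^[3] (fun X' : ℝ => kernelT ε σ ν X')) X‖ ≤ C * (y ^ 3 * (ν ^ (-σ) * (X + 3 * y) ^ (1 - σ))) := by
  obtain ⟨C, hC, hG⟩ := exists_norm_kernelG_le (σ₂ := σ₂) h₁
  set A : ℝ := 5 + |σ₁| + |σ₂| with hA
  set J : ℝ := ∫ u : ℝ, (1 + |u|) ^ (4 * σ₂ - 3) with hJ
  have hJ0 : 0 ≤ J := integral_one_add_abs_rpow_nonneg _
  have hJint : Integrable fun u : ℝ => (1 + |u|) ^ (4 * σ₂ - 3) := by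
    have := integrable_one_add_norm (E := ℝ) (μ := volume) (r := 3 - 4 * σ₂) (by simp; linarith)
    refine this.congr (ae_of_all _ fun u => ?_)
    simp only [Real.norm_eq_abs]; congr 1; ring
  refine ⟨1 / (2 * π) * C * A ^ 3 * J + 1, by positivity, fun ε hε σ hσ ν X y hν hX hy => ?_⟩
  have hσ1 : 1 / 6 < σ := lt_of_lt_of_le h₁ hσ.1
  have hσ2 : σ < 1 / 2 := lt_of_le_of_lt hσ.2 h₂
  set P : ℝ := y ^ 3 * (ν ^ (-σ) * (X + 3 * y) ^ (1 - σ)) with hP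
  have hP0 : 0 ≤ P := by positivity
  -- pointwise bound for the differenced integrand
  have hbound : ∀ u : ℝ, ‖((fwdDiff y)^[3] (fun X' : ℝ => kernelIntegrand ε ν X' ((σ : ℂ) + u * I))) X‖ ≤
      C * A ^ 3 * P * (1 + |u|) ^ (4 * σ₂ - 3) := by
    intro u
    set w : ℂ := (σ : ℂ) + u * I with hw
    have hwre : w.re = σ := by simp [hw]
    rw [fwdDiff_three_kernelIntegrand, norm_mul, norm_mul, norm_cpow_eq_rpow_re_of_pos hν, neg_re, hwre]
    have hG' := hG ε hε σ hσ u
    -- `‖Δ_y^3 X^{4−w}‖ ≤ y³ ‖(4−w)(3−w)(2−w)‖ (X+3y)^{1−σ}`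
    have hD := norm_fwdDiff_three_cpow_le (4 - w) hX hy
    have hre3 : (4 - w).re - 3 = 1 - σ := by rw [sub_re, hwre]; norm_num; ring
    rw [hre3] at hD
    have hmax : max (X ^ (1 - σ)) ((X + 3 * y) ^ (1 - σ)) = (X + 3 * y) ^ (1 - σ) :=
      max_eq_right (Real.rpow_le_rpow hX.le (by linarith) (by linarith))
    rw [hmax] at hD
    have hpoly : ‖(4 - w) * (4 - w - 1) * (4 - w - 2)‖ ≤ (A * (1 + |u|)) ^ 3 := by
      have e4 : (4 : ℂ) - w = ((4 : ℝ) : ℂ) - ((σ : ℂ) + u * I) := by rw [hw]; push_cast; ring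
      have e3 : (4 : ℂ) - w - 1 = ((3 : ℝ) : ℂ) - ((σ : ℂ) + u * I) := by rw [hw]; push_cast; ring
      have e2 : (4 : ℂ) - w - 2 = ((2 : ℝ) : ℂ) - ((σ : ℂ) + u * I) := by rw [hw]; push_cast; ring
      have n4 := norm_sub_le_mul hσ u (k := 4) (by norm_num) le_rfl
      have n3 := norm_sub_le_mul hσ u (k := 3) (by norm_num) (by norm_num)
      have n2 := norm_sub_le_mul hσ u (k := 2) (by norm_num) (by norm_num)
      rw [← e4] at n4; rw [← e3] at n3; rw [← e2] at n2
      calc ‖(4 - w) * (4 - w - 1) * (4 - w - 2)‖ = ‖4 - w‖ * ‖4 - w - 1‖ * ‖4 - w - 2‖ := by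
            rw [norm_mul, norm_mul]
        _ ≤ (A * (1 + |u|)) * (A * (1 + |u|)) * (A * (1 + |u|)) :=
            mul_le_mul (mul_le_mul n4 n3 (norm_nonneg _) (by positivity)) n2 (norm_nonneg _) (by positivity)
        _ = (A * (1 + |u|)) ^ 3 := by ring
    have hmono : (1 + |u|) ^ (4 * σ - 6) * (1 + |u|) ^ (3 : ℕ) ≤ (1 + |u|) ^ (4 * σ₂ - 3) := by
      rw [← Real.rpow_natCast, ← Real.rpow_add (by positivity)]
      exact Real.rpow_le_rpow_of_exponent_le (by linarith [abs_nonneg u]) (by push_cast; linarith [hσ.2])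
    calc ‖kernelG ε w‖ * (ν ^ (-σ) * ‖((fwdDiff y)^[3] (fun X' : ℝ => ((X' : ℂ)) ^ (4 - w))) X‖)
        ≤ C * (1 + |u|) ^ (4 * σ - 6) *
            (ν ^ (-σ) * (y ^ 3 * ((A * (1 + |u|)) ^ 3 * (X + 3 * y) ^ (1 - σ)))) := by
          refine mul_le_mul hG' (mul_le_mul_of_nonneg_left (hD.trans ?_) (by positivity)) (by positivity)
            (by positivity)
          exact mul_le_mul_of_nonneg_left (mul_le_mul_of_nonneg_right hpoly (by positivity)) (by positivity)
      _ = C * A ^ 3 * P * ((1 + |u|) ^ (4 * σ - 6) * (1 + |u|) ^ (3 : ℕ)) := by rw [hP]; ring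
      _ ≤ C * A ^ 3 * P * (1 + |u|) ^ (4 * σ₂ - 3) := by gcongr
  rw [fwdDiff_three_kernelT hν hX hy hε hσ1 (by linarith), norm_mul]
  have h2π : ‖(1 / (2 * π) : ℂ)‖ = 1 / (2 * π) := by
    rw [show (1 / (2 * π) : ℂ) = ((1 / (2 * π) : ℝ) : ℂ) by push_cast; ring, Complex.norm_real, Real.norm_eq_abs,
      abs_of_pos (by positivity)]
  rw [h2π]
  have hnorm : ‖∫ u : ℝ, ((fwdDiff y)^[3] (fun X' : ℝ => kernelIntegrand ε ν X' ((σ : ℂ) + u * I))) X‖ ≤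
      C * A ^ 3 * P * J := by
    calc _ ≤ ∫ u : ℝ, C * A ^ 3 * P * (1 + |u|) ^ (4 * σ₂ - 3) :=
          norm_integral_le_of_norm_le (hJint.const_mul _) (ae_of_all _ hbound)
      _ = C * A ^ 3 * P * J := by rw [integral_const_mul]
  calc 1 / (2 * π) * ‖∫ u : ℝ, ((fwdDiff y)^[3] (fun X' : ℝ => kernelIntegrand ε ν X' ((σ : ℂ) + u * I))) X‖
      ≤ 1 / (2 * π) * (C * A ^ 3 * P * J) := by gcongr
    _ = (1 / (2 * π) * C * A ^ 3 * J) * P := by ring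
    _ ≤ (1 / (2 * π) * C * A ^ 3 * J + 1) * P := by nlinarith

end ShintaniGamma

end Literature.NumberTheory.CubicFields

end
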